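import Literature.AnabelianGeometry.EtaleTheta.Discharge.Sec5Thm510iiiOfThetaSettingYddOfDeltaCharacteristic
import Literature.IUT.HodgeArakelov.ThetaSettingDeltaCharacteristicViaYuu
import Literature.IUT.HodgeArakelov.ThetaSettingDeltaCharacteristicGenuine
import Literature.IUT.HodgeArakelov.ThetaSettingDeltaCharacteristicAtModelTateDischarge

/-!
# The (H1) «`Δ ⊆ Π` characteristic» suppliers of the [IUTchII] §1 setting PLUGGED INTO the [EtTh] Theorem 5.10 (ii) ∧ (iii)
# END form at the Ÿ̲̲-junction data (the F-0620-free closers of `Sec5Thm510iiiOfThetaSettingYddOfDeltaCharacteristic`)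

S. Mochizuki, *The étale theta function and its Frobenioid-theoretic manifestations* [EtTh], Publ. RIMS **45** (2009),
Thm. 5.10 (ii)(iii) pp. 333–335 (PDF pp. 107–109) [cite: MochizukiEtTh2009, Thm 5.10 (iii) p.334 (PDF p.108)]; S. Mochizuki,
*Inter-universal Teichmüller theory II*, §1, Example 1.8 (i) (kurims p. 35: «the [group-theoretic! — cf., e.g., [AbsAnab], Lemma 1.3.8]
subgroup corresponding to `Δ^tp_{X̲̲_k}`») [claim: Mochizuki2012, status: disputed]; S. Mochizuki, *Topics in absolute anabelian geometry I*,
Thm. 2.6 (v) p. 22 [cite: MochizukiAbsTopI2012, Thm 2.6 (v) p.22].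

abc-iut cell, seat abc-iut-w6-d053 (gen 7; rows `EtTh:Thm5.10(ii)`, `EtTh:Thm5.10(iii)`, L2-lead R940 «if a model junction instantiates …»).
PROOF-ONLY (0 definitions, 0 instances, 0 new `Prop` facts; nothing landed is edited).  The companion
`Sec5Thm510iiiOfThetaSettingYddOfDeltaCharacteristic` (this seat) re-keyed the Theorem 5.10 (ii) ∧ (iii) END form at the Ÿ̲̲-junction so that the
F-0620 slot is the binder `hΔX : IsTopCharacteristic C.Huu (D.DeltaTemp.subgroupOf C.Huu)` («`Δ^tp_X̲̲ ⊆ Π^tp_X̲̲` characteristic»).  Here that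
binder is SUPPLIED from the layer-L6 (H1) currency of the [IUTchII] §1 setting `S := ThetaSetting.ofDoubleUnderline C μ hC hS hl hp2 hpl hζ hη`
(`Π^{(S)} = C.Huu`; abc-iut-w4-d043's `ThetaSetting.deltaX_ofDoubleUnderline_eq`: `S.DeltaX = D.DeltaTemp.subgroupOf C.Huu`):
§1 (bridges, EtTh vocabulary out): `isTopCharacteristic_deltaTemp_subgroupOf_Huu_of_deltaX_ofDoubleUnderline` (⟸ (H1) for `S`),
`…_of_completion_preservesGeom` (⟸ [AbsAnab] Lem. 1.3.8 = FACT-LIST F-0007 `PreservesGeom` BY NAME at a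
compatible completion package of `Π^tp_X̲̲`, abc-iut-w5-d233's `deltaX_map_eq_of_completion_compatible`),
`…_of_regime` (⟸ abc-iut-w5-d233's `deltaX_characteristic_ofDoubleUnderline_of_regime`: ONE [AbsTopI] Thm 2.6 (v) regime hypothesis on the
compatible MLF completion packages of `Π^tp_X̲̲` — `Δ_E` topologically finitely generated + `CoinvariantRankConstant`, FACT-LIST F-0001 BY NAME;
the package EXISTS by `exists_completion_package_ofDoubleUnderline`, and [AbsAnab] Lem. 1.3.8 `PreservesGeom` (F-0007) is then a THEOREM at
the package by abc-iut-w5-d206's `FundamentalExtension.preservesGeom_of_coinvariantRankConstant`),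
`SettingModel.isTopCharacteristic_deltaTemp_subgroupOf_Huu_modelχq_of_ker_ne_bot` (⟸ abc-iut-w4-d044's
`deltaX_characteristic_ofDoubleUnderline_modelχq_of_ker_ne_bot` at the stage-2 Tate models: {`eΔ`, `hI0`}, NO anabelian hypothesis).
§2 the Theorem 5.10 (ii) ∧ (iii) `_canonical` END forms at the Ÿ̲̲-junction with the F-0620 slot so supplied:
`ThetaFrobenioid.thm510_ii_iii_ofThetaSettingYdd_of_deltaX_ofDoubleUnderline_canonical` (⟸ (H1) for `S`),
(the Thm 2.6 (v) regime form is ONE term: `… (C.isTopCharacteristic_deltaTemp_subgroupOf_Huu_of_regime … hreg) …`),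
`ThetaFrobenioid.thm510_ii_iii_ofThetaSettingYdd_modelχq_of_ker_ne_bot_canonical` (at `D := ThetaSetting.modelχq p i j hj`, ⟸ {`eΔ`, `hI0`}).

RESIDUAL OF RECORD (numbers, not adjectives): {junction data (`tf`, `h`, `Q`, roots `R`, `K'`, `constEmb`, `hinvc`, `hinvp`), `hconst`, `hD`, `m`,
Thm. 5.7 / Thm. 4.4 (iv) transports AS TYPED, `ψY`} ∪ {the [IUTchII] §1 setting's extra arguments `hl`, `hp2`, `hpl`, `hζ`, a theta cocycle `η`}
∪ ONE OF {(H1) for `S`} / {`hreg` (F-0001 regime at the packages)} / {`U`, `hU`, `eΔ`, `hI0`} (Tate models) — NO F-0620, NO `h15`, NO `L`, NO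
`PreservesGeom`/Cor. 2.18 binder.  HONEST FRAMING: kernel-checked compositions of landed theorems; `tf` is an abstract parameter not inhabited in
the tree; `modelχq` is a SEMI-SYNTHETIC model (binder-discharge evidence for OUR typed interface); F-0001 / `eΔ` / `hI0` are hypotheses displayed
BY NAME; nothing of [EtTh]/[IUTchII] is asserted unconditionally; typed ≠ proved; instantiated ≠ endorsed; no side is taken on [IUTchIII] Cor. 3.12;
nothing here says abc is proved or refuted.
-/

noncomputable section

namespace Literature.AnabelianGeometry.EtaleTheta

open CategoryTheory Opposite Literature.AlgebraicGeometry.Frobenioids Literature.AnabelianGeometry.SemiGraphs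
  Literature.AnabelianGeometry.SemiGraphs.GaloisObjects Literature.AlgebraicGeometry.Frobenioids.QuasiTemperoid.BTempConnected
  Literature.AnabelianGeometry.AbsoluteAnabelian
open scoped Pointwise

/-! ### §1. (H1) of the [IUTchII] §1 setting ⇒ «`Δ^tp_X̲̲ ⊆ Π^tp_X̲̲` characteristic» in the [EtTh] vocabulary -/

namespace ThetaSetting.EtaleThetaData.DoubleUnderline

variable {p : ℕ} [Fact p.Prime] {D : ThetaSetting p} {E : D.EtaleThetaData} {l : ℕ} (C : E.DoubleUnderline l) {N : ℕ+}
  (μ : D.CyclotomeMod l N) (hC : D.Compat) (hS : D.Sec2Hyps) (hl : l.Prime) (hp2 : p ≠ 2) (hpl : p ≠ l)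
  (hζ : ∃ ζ : D.K, IsPrimitiveRoot ζ (4 * l)) {η : (C.thetaEnvData μ hC hS).PiYdd → MuN p N}
  (hη : η ∈ (C.thetaEnvData μ hC hS).thetaCocycles)

/-- **(H1) for the [IUTchII] §1 setting `S := ofDoubleUnderline …` IS «`Δ^tp_X̲̲ ⊆ Π^tp_X̲̲` characteristic»** (`Π^{(S)} = C.Huu` and
`S.DeltaX = Δ^tp_X ∩ Π^tp_X̲̲`, abc-iut-w4-d043's `deltaX_ofDoubleUnderline_eq`).
[claim: Mochizuki2012, status: disputed] (IUTchII §1 Ex 1.8 (i), kurims p.35) -/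
theorem isTopCharacteristic_deltaTemp_subgroupOf_Huu_of_deltaX_ofDoubleUnderline
    (hH1 : ∀ φ : (Literature.IUT.HodgeArakelov.ThetaSetting.ofDoubleUnderline C μ hC hS hl hp2 hpl hζ hη).PiX ≃ₜ*
        (Literature.IUT.HodgeArakelov.ThetaSetting.ofDoubleUnderline C μ hC hS hl hp2 hpl hζ hη).PiX,
      (Literature.IUT.HodgeArakelov.ThetaSetting.ofDoubleUnderline C μ hC hS hl hp2 hpl hζ hη).DeltaX.map φ.toMulEquiv.toMonoidHom =
        (Literature.IUT.HodgeArakelov.ThetaSetting.ofDoubleUnderline C μ hC hS hl hp2 hpl hζ hη).DeltaX) :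
    IsTopCharacteristic C.Huu (D.DeltaTemp.subgroupOf C.Huu) := by
  rw [Literature.IUT.HodgeArakelov.ThetaSetting.deltaX_ofDoubleUnderline_eq] at hH1
  exact hH1

/-- **«`Δ^tp_X̲̲ ⊆ Π^tp_X̲̲` characteristic» modulo ONE [AbsTopI] Thm 2.6 (v) regime hypothesis** on the compatible MLF completion packages of
`Π^tp_X̲̲` (`Δ_E` topologically finitely generated + `CoinvariantRankConstant` = FACT-LIST F-0001 BY NAME; the package exists, and [AbsAnab]
Lem. 1.3.8 `PreservesGeom` is a theorem there) — abc-iut-w5-d233's `deltaX_characteristic_ofDoubleUnderline_of_regime` through the bridge.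
[cite: MochizukiAbsTopI2012, Thm 2.6 (v) p.22] -/
theorem isTopCharacteristic_deltaTemp_subgroupOf_Huu_of_regime
    (hreg : ∀ (F : FundamentalExtension.{0}) (_ : F.MLFBase)
      (ι : (Literature.IUT.HodgeArakelov.ThetaSetting.ofDoubleUnderline C μ hC hS hl hp2 hpl hζ hη).PiX →ₜ* F.arith)
      (g : (Literature.IUT.HodgeArakelov.ThetaSetting.ofDoubleUnderline C μ hC hS hl hp2 hpl hζ hη).Gk →* F.gal),
      IsProfiniteCompletion ι → Function.Injective g →
        (∀ x, F.aug (ι x) = g ((Literature.IUT.HodgeArakelov.ThetaSetting.ofDoubleUnderline C μ hC hS hl hp2 hpl hζ hη).aug x)) →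
        IsTopologicallyFinitelyGenerated F.geom ∧ F.CoinvariantRankConstant) :
    IsTopCharacteristic C.Huu (D.DeltaTemp.subgroupOf C.Huu) :=
  C.isTopCharacteristic_deltaTemp_subgroupOf_Huu_of_deltaX_ofDoubleUnderline μ hC hS hl hp2 hpl hζ hη
    (Literature.IUT.HodgeArakelov.ThetaSetting.deltaX_characteristic_ofDoubleUnderline_of_regime C μ hC hS hl hp2 hpl hζ hη hreg)

/-- **«`Δ^tp_X̲̲ ⊆ Π^tp_X̲̲` characteristic» from [AbsAnab] Lem. 1.3.8 BY NAME (FACT-LIST F-0007 `PreservesGeom`) AT A COMPATIBLE COMPLETION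
PACKAGE of `Π^tp_X̲̲`** (a profinite completion `ι : Π^tp_X̲̲ → Π_F` into an extension `1 → Δ_F → Π_F → G_F → 1` with `aug_F ∘ ι = g ∘ aug`, `g`
injective — such a package EXISTS, `exists_completion_package_ofDoubleUnderline`; F-0007 bound at the instance `F` for all automorphisms of `Π_F`)
— abc-iut-w5-d233's `deltaX_map_eq_of_completion_compatible` through the bridge.  [cite: MochizukiAbsAnab2004, Lemma 1.3.8 p.18] -/
theorem isTopCharacteristic_deltaTemp_subgroupOf_Huu_of_completion_preservesGeom (F : FundamentalExtension.{0})
    (ι : (Literature.IUT.HodgeArakelov.ThetaSetting.ofDoubleUnderline C μ hC hS hl hp2 hpl hζ hη).PiX →ₜ* F.arith)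
    (hι : IsProfiniteCompletion ι) (g : (Literature.IUT.HodgeArakelov.ThetaSetting.ofDoubleUnderline C μ hC hS hl hp2 hpl hζ hη).Gk →* F.gal)
    (hg : Function.Injective g) (h : ∀ x, F.aug (ι x) = g ((Literature.IUT.HodgeArakelov.ThetaSetting.ofDoubleUnderline C μ hC hS hl hp2 hpl hζ hη).aug x))
    (h138 : ∀ φ : F.arith ≃ₜ* F.arith, FundamentalExtension.PreservesGeom φ) :
    IsTopCharacteristic C.Huu (D.DeltaTemp.subgroupOf C.Huu) :=
  C.isTopCharacteristic_deltaTemp_subgroupOf_Huu_of_deltaX_ofDoubleUnderline μ hC hS hl hp2 hpl hζ hη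
    (Literature.IUT.HodgeArakelov.ThetaSetting.deltaX_map_eq_of_completion_compatible _ F ι hι g hg h h138)

end ThetaSetting.EtaleThetaData.DoubleUnderline

namespace SettingModel

open Literature.IUT.HodgeTheaters (profiniteCompletion)

variable (p : ℕ) [Fact p.Prime] (i j : ℤ) (hj : Even j) {ED : (ThetaSetting.modelχq p i j hj).EtaleThetaData} {l : ℕ}
  (C : ED.DoubleUnderline l) {N : ℕ+} (μ : (ThetaSetting.modelχq p i j hj).CyclotomeMod l N) (hC : (ThetaSetting.modelχq p i j hj).Compat)
  (hS : (ThetaSetting.modelχq p i j hj).Sec2Hyps) (hl : l.Prime) (hp2 : p ≠ 2) (hpl : p ≠ l)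
  (hζ : ∃ ζ : (ThetaSetting.modelχq p i j hj).K, IsPrimitiveRoot ζ (4 * l))
  {η : (C.thetaEnvData μ hC hS).PiYdd → MuN p N} (hη : η ∈ (C.thetaEnvData μ hC hS).thetaCocycles)

/-- **«`Δ^tp_X̲̲ ⊆ Π^tp_X̲̲` characteristic» AT THE STAGE-2 TATE MODELS `modelχq p i j`, modulo {`eΔ`, `hI0`} and NO anabelian hypothesis**
(abc-iut-w4-d044's `deltaX_characteristic_ofDoubleUnderline_modelχq_of_ker_ne_bot` through the bridge): `eΔ` identifies the geometric part of
THE completion package with an open subgroup of `F̂₂`; `hI0` = «the Tate character pair is not injective on `G_{ℚ_p}`».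
[claim: Mochizuki2012, status: disputed] (IUTchII §1 Ex 1.8 (i), kurims p.35) [cite: MochizukiAbsTopI2012, Thm 2.6 (v) p.22] -/
theorem isTopCharacteristic_deltaTemp_subgroupOf_Huu_modelχq_of_ker_ne_bot (hI0 : (tatePairHom p i j).ker ≠ ⊥)
    (U : Subgroup (profiniteCompletion (FreeGroup (Fin 2)))) (hU : IsOpen (U : Set (profiniteCompletion (FreeGroup (Fin 2)))))
    (eΔ : ((Literature.IUT.HodgeArakelov.ThetaSetting.ofDoubleUnderline C μ hC hS hl hp2 hpl hζ hη).completionPackage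
        (ThetaSetting.modelχq p i j hj).K (ThetaSetting.modelχq p i j hj).toTemperedCurve.galoisIdentification).geom ≃ₜ* U) :
    IsTopCharacteristic C.Huu ((ThetaSetting.modelχq p i j hj).DeltaTemp.subgroupOf C.Huu) :=
  C.isTopCharacteristic_deltaTemp_subgroupOf_Huu_of_deltaX_ofDoubleUnderline μ hC hS hl hp2 hpl hζ hη
    (deltaX_characteristic_ofDoubleUnderline_modelχq_of_ker_ne_bot p i j hj C μ hC hS hl hp2 hpl hζ hη hI0 U hU eΔ)

end SettingModel

/-! ### §2. The Theorem 5.10 (ii) ∧ (iii) END form at the Ÿ̲̲-junction with the (H1) suppliers plugged in -/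

universe v₀

namespace ThetaFrobenioid

section YddJunction

variable {p : ℕ} [Fact p.Prime] {D : ThetaSetting p} {E : D.EtaleThetaData} {l : ℕ} {C : E.DoubleUnderline l}
  {e : D.toTemperedCurve.GroupLevelData} {N : ℕ+} (μ : D.CyclotomeMod l N) (hC : D.Compat) (hS : D.Sec2Hyps)
  {D₀ : Type} [Category.{v₀} D₀] {V : FrdIMonoidStub.{0}} {T₀ : RealifiedDivisorMonoids (D₀ := D₀) V}
  {VD : FrdICatStub.{1, 0, 0} (ConnectedPart (BTemp (C.temperedArithmeticGroup e).Pi))}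
  {tf : TemperedFrobenioid T₀ (ConnectedPart (BTemp (C.temperedArithmeticGroup e).Pi)) VD} {hZ : tf.monoidType = MonoidType.Z}
  {hP : ∀ A : (ConnectedPart (BTemp (C.temperedArithmeticGroup e).Pi))ᵒᵖ, IsPerfect (tf.Φ.carrier A)}
  {NH : Subgroup (Field.absoluteGaloisGroup D.K) → tf.category → ℕ+ → Prop}
  {pullFrac : ∀ {A A' : (BiKummerSetting.mkOfThetaSettingYdd C e μ hC hS tf hZ hP NH).C} (_ : A' ⟶ A),
    (BiKummerSetting.mkOfThetaSettingYdd C e μ hC hS tf hZ hP NH).biratUnits A →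
      (BiKummerSetting.mkOfThetaSettingYdd C e μ hC hS tf hZ hP NH).biratUnits A'}
  {θ : (BiKummerSetting.mkOfThetaSettingYdd C e μ hC hS tf hZ hP NH).biratUnits (BiKummerSetting.mkOfThetaSettingYdd C e μ hC hS tf hZ hP NH).Aodot}
  {Bl : (BiKummerSetting.mkOfThetaSettingYdd C e μ hC hS tf hZ hP NH).C}
  {Pl : (BiKummerSetting.mkOfThetaSettingYdd C e μ hC hS tf hZ hP NH).FractionPair θ Bl}
  {Rl : (BiKummerSetting.mkOfThetaSettingYdd C e μ hC hS tf hZ hP NH).NthRoot θ Pl C.lPNat pullFrac}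
  (h : ModelFrobenioid.Hypotheses tf.divisorMonoid tf.ratFnFunctor)
  (Q : FrobenioidTheta.ThetaSubquotientStub.{0} (ConnectedPart (BTemp (C.temperedArithmeticGroup e).Pi)))
  (R : (BiKummerSetting.mkOfThetaSettingYdd C e μ hC hS tf hZ hP NH).NthRoot Rl.root Rl.pair N pullFrac)
  (K' : Type) [Field K'] (constEmb : K'ˣ →* tf.biratUnitsModel R.BN) (constEmb_injective : Function.Injective constEmb)
  (hinvc : ∀ g : Aut R.AN.base,
    pull tf.divisorMonoid g.hom (ModelFrobenioid.div R.pair.num) = ModelFrobenioid.div R.pair.num)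
  (hinvp : ∀ y : (C.thetaEnvData μ hC hS).PiX, y ∈ (C.thetaEnvData μ hC hS).PiYdd →
    pull tf.divisorMonoid ((BiKummerSetting.mkOfThetaSettingYdd C e μ hC hS tf hZ hP NH).galoisSurj
      R.AN.base R.αData.isGalois ((ContinuousMulEquiv.refl _) y)).hom (ModelFrobenioid.div R.pair.den) = ModelFrobenioid.div R.pair.den)
  (hconst : ∀ (ε : Aut R.BN) (k : K'ˣ), tf.biratAutModel R.BN ε (constEmb k) = constEmb k)
  (m : (ofThetaSettingData μ hC hS h Q R K' constEmb constEmb_injective hinvc hinvp).muTorsion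
      (ofThetaSettingData μ hC hS h Q R K' constEmb constEmb_injective hinvc hinvp).BN N ≃* (C.thetaEnvData μ hC hS).mu)
  {Cst : Subgroup ((ofThetaSettingData μ hC hS h Q R K' constEmb constEmb_injective hinvc hinvp).biratUnits
      (ofThetaSettingData μ hC hS h Q R K' constEmb constEmb_injective hinvc hinvp).BN)}
  {ν' : Cst →* (PadicAlgCl p)ˣ}
  (hD : BiratAutAction.ConstantsDictionary
    (biratAutAction_ofConnectedTemperoidData (T := C.thetaEnvData μ hC hS) h Q C.odd_lPNat R (ContinuousMulEquiv.refl _) K' constEmb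
      constEmb_injective hinvc hinvp hconst) C μ hC hS (ContinuousMulEquiv.refl _) m Cst ν')
  (hl : l.Prime) (hp2 : p ≠ 2) (hpl : p ≠ l) (hζ : ∃ ζ : D.K, IsPrimitiveRoot ζ (4 * l))
  {η : (C.thetaEnvData μ hC hS).PiYdd → MuN p N} (hη : η ∈ (C.thetaEnvData μ hC hS).thetaCocycles)

/-- **[EtTh] Theorem 5.10 (ii) ∧ (iii) AT THE Ÿ̲̲-JUNCTION DATA, `_canonical` END FORM, the F-0620 slot supplied by (H1) of the [IUTchII] §1
setting `S := ofDoubleUnderline C μ hC hS hl hp2 hpl hζ hη`** (so that EVERY layer-L6 (H1) producer for `S` plugs in BY NAME).  RESIDUAL EXACTLY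
{junction data, `hconst`, `hD`, `m`, the transports, `ψY`} ∪ {`hl`, `hp2`, `hpl`, `hζ`, `η`/`hη`, (H1) for `S`}.
[cite: MochizukiEtTh2009, Thm 5.10 (ii)(iii) p.333–335 (PDF pp.107–109)] -/
theorem thm510_ii_iii_ofThetaSettingYdd_of_deltaX_ofDoubleUnderline_canonical
    (hH1 : ∀ φ : (Literature.IUT.HodgeArakelov.ThetaSetting.ofDoubleUnderline C μ hC hS hl hp2 hpl hζ hη).PiX ≃ₜ*
        (Literature.IUT.HodgeArakelov.ThetaSetting.ofDoubleUnderline C μ hC hS hl hp2 hpl hζ hη).PiX,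
      (Literature.IUT.HodgeArakelov.ThetaSetting.ofDoubleUnderline C μ hC hS hl hp2 hpl hζ hη).DeltaX.map φ.toMulEquiv.toMonoidHom =
        (Literature.IUT.HodgeArakelov.ThetaSetting.ofDoubleUnderline C μ hC hS hl hp2 hpl hζ hη).DeltaX)
    (Ψ : (BiKummerSetting.mkOfThetaSettingYdd C e μ hC hS tf hZ hP NH).C ≌ (BiKummerSetting.mkOfThetaSettingYdd C e μ hC hS tf hZ hP NH).C)
    (β : Ψ.functor.obj (ofThetaSettingData μ hC hS h Q R K' constEmb constEmb_injective hinvc hinvp).BN ≅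
      (ofThetaSettingData μ hC hS h Q R K' constEmb constEmb_injective hinvc hinvp).BN)
    (ΨbiratAut : (ofThetaSettingData μ hC hS h Q R K' constEmb constEmb_injective hinvc hinvp).biratUnits
        (ofThetaSettingData μ hC hS h Q R K' constEmb constEmb_injective hinvc hinvp).BN ≃*
      (ofThetaSettingData μ hC hS h Q R K' constEmb constEmb_injective hinvc hinvp).biratUnits
        (ofThetaSettingData μ hC hS h Q R K' constEmb constEmb_injective hinvc hinvp).BN)
    (Ψbs : ConnectedPart (BTemp (C.temperedArithmeticGroup e).Pi) ⥤ ConnectedPart (BTemp (C.temperedArithmeticGroup e).Pi))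
    [Ψbs.Faithful]
    (eΨ : Ψ.functor ⋙ (ofThetaSettingData μ hC hS h Q R K' constEmb constEmb_injective hinvc hinvp).base ≅
      (ofThetaSettingData μ hC hS h Q R K' constEmb constEmb_injective hinvc hinvp).base ⋙ Ψbs)
    (hsq : ∀ u : (ofThetaSettingData μ hC hS h Q R K' constEmb constEmb_injective hinvc hinvp).units
        (ofThetaSettingData μ hC hS h Q R K' constEmb constEmb_injective hinvc hinvp).BN,
      ∀ hu : (ofThetaSettingData μ hC hS h Q R K' constEmb constEmb_injective hinvc hinvp).psiAut Ψ β u ∈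
        (ofThetaSettingData μ hC hS h Q R K' constEmb constEmb_injective hinvc hinvp).units
          (ofThetaSettingData μ hC hS h Q R K' constEmb constEmb_injective hinvc hinvp).BN,
      ΨbiratAut ((ofThetaSettingData μ hC hS h Q R K' constEmb constEmb_injective hinvc hinvp).unitsToBirat
          (ofThetaSettingData μ hC hS h Q R K' constEmb constEmb_injective hinvc hinvp).BN u) =
        (ofThetaSettingData μ hC hS h Q R K' constEmb constEmb_injective hinvc hinvp).unitsToBirat
          (ofThetaSettingData μ hC hS h Q R K' constEmb constEmb_injective hinvc hinvp).BN ⟨_, hu⟩)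
    (hΨconst : (ofThetaSettingData μ hC hS h Q R K' constEmb constEmb_injective hinvc hinvp).constEmb.range.map ΨbiratAut.toMonoidHom =
      (ofThetaSettingData μ hC hS h Q R K' constEmb constEmb_injective hinvc hinvp).constEmb.range)
    (αA : Ψ.functor.obj (ofThetaSettingData μ hC hS h Q R K' constEmb constEmb_injective hinvc hinvp).AN ≅
      (ofThetaSettingData μ hC hS h Q R K' constEmb constEmb_injective hinvc hinvp).AN)
    (eA : (ofThetaSettingData μ hC hS h Q R K' constEmb constEmb_injective hinvc hinvp).AN ≅
      (ofThetaSettingData μ hC hS h Q R K' constEmb constEmb_injective hinvc hinvp).AN)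
    (Dc Dp : Aut (ofThetaSettingData μ hC hS h Q R K' constEmb constEmb_injective hinvc hinvp).BN)
    (hRT : (ofThetaSettingData μ hC hS h Q R K' constEmb constEmb_injective hinvc hinvp).RootTransportWith Ψ αA β eA Dc Dp)
    (θA : Aut ((ofThetaSettingData μ hC hS h Q R K' constEmb constEmb_injective hinvc hinvp).base.obj
        (ofThetaSettingData μ hC hS h Q R K' constEmb constEmb_injective hinvc hinvp).BN) ≃*
      Aut ((ofThetaSettingData μ hC hS h Q R K' constEmb constEmb_injective hinvc hinvp).base.obj
        (ofThetaSettingData μ hC hS h Q R K' constEmb constEmb_injective hinvc hinvp).BN))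
    (hST : (ofThetaSettingData μ hC hS h Q R K' constEmb constEmb_injective hinvc hinvp).StrvTransport Ψ αA eA θA)
    (hθY : (ofThetaSettingData μ hC hS h Q R K' constEmb constEmb_injective hinvc hinvp).imPiY.map θA.toMonoidHom =
      (ofThetaSettingData μ hC hS h Q R K' constEmb constEmb_injective hinvc hinvp).imPiY)
    (hθYdd : (ofThetaSettingData μ hC hS h Q R K' constEmb constEmb_injective hinvc hinvp).HB.map θA.toMonoidHom =
      (ofThetaSettingData μ hC hS h Q R K' constEmb constEmb_injective hinvc hinvp).HB)
    (ψY : (ofThetaSettingData μ hC hS h Q R K' constEmb constEmb_injective hinvc hinvp).PiX ≃ₜ*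
      (ofThetaSettingData μ hC hS h Q R K' constEmb constEmb_injective hinvc hinvp).PiX)
    (hbase : ∀ g, (ofThetaSettingData μ hC hS h Q R K' constEmb constEmb_injective hinvc hinvp).autBase
        (ofThetaSettingData μ hC hS h Q R K' constEmb constEmb_injective hinvc hinvp).BN
        ((ofThetaSettingData μ hC hS h Q R K' constEmb constEmb_injective hinvc hinvp).psiAut Ψ β
          ((ofThetaSettingData μ hC hS h Q R K' constEmb constEmb_injective hinvc hinvp).sgpCap
            ((ofThetaSettingData μ hC hS h Q R K' constEmb constEmb_injective hinvc hinvp).ρ g))) =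
      (ofThetaSettingData μ hC hS h Q R K' constEmb constEmb_injective hinvc hinvp).ρ (ψY g))
    (hψY : (ofThetaSettingData μ hC hS h Q R K' constEmb constEmb_injective hinvc hinvp).PiY.map ψY.toMulEquiv.toMonoidHom =
      (ofThetaSettingData μ hC hS h Q R K' constEmb constEmb_injective hinvc hinvp).PiY)
    (hψYdd : (ofThetaSettingData μ hC hS h Q R K' constEmb constEmb_injective hinvc hinvp).PiYdd.map ψY.toMulEquiv.toMonoidHom =
      (ofThetaSettingData μ hC hS h Q R K' constEmb constEmb_injective hinvc hinvp).PiYdd) :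
    (ofThetaSettingData μ hC hS h Q R K' constEmb constEmb_injective hinvc hinvp).PsiAutPreserves Ψ β ΨbiratAut ∧
      (ofThetaSettingData μ hC hS h Q R K' constEmb constEmb_injective hinvc hinvp).MonoThetaEnvCompat
        (facts_ofThetaSettingYddData_of_constantsDictionary (hD' := hD)).sectionsFactor
        (ofThetaSettingData μ hC hS h Q R K' constEmb constEmb_injective hinvc hinvp).outerActionLZ_of
        (facts_ofThetaSettingYddData_of_constantsDictionary (hD' := hD)).sgpCapSection
        (facts_ofThetaSettingYddData_of_constantsDictionary (hD' := hD)).sgpCupSection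
        (facts_ofThetaSettingYddData_of_constantsDictionary (hD' := hD)).constantsEqNormalizer
        (dkOfConnectedTemperoidData (T := C.thetaEnvData μ hC hS) h Q C.odd_lPNat R (ContinuousMulEquiv.refl _) K' constEmb
          constEmb_injective hinvc hinvp hconst
          (kxRootNModCyclotome_ofThetaSettingData_of_constantsDictionary μ hC hS h Q R K' constEmb constEmb_injective hinvc hinvp hconst m hD))
        Ψ β ψY hbase hψY hψYdd :=
  thm510_ii_iii_ofThetaSettingYdd_of_isTopCharacteristic_canonical μ hC hS h Q R K' constEmb constEmb_injective hinvc hinvp hconst m hD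
    (C.isTopCharacteristic_deltaTemp_subgroupOf_Huu_of_deltaX_ofDoubleUnderline μ hC hS hl hp2 hpl hζ hη hH1) Ψ β ΨbiratAut Ψbs eΨ hsq
    hΨconst αA eA Dc Dp hRT θA hST hθY hθYdd ψY hbase hψY hψYdd

end YddJunction

section TateJunction

open Literature.IUT.HodgeTheaters (profiniteCompletion)

variable (p : ℕ) [Fact p.Prime] (i j : ℤ) (hj : Even j) {E : (ThetaSetting.modelχq p i j hj).EtaleThetaData} {l : ℕ} {C : E.DoubleUnderline l}
  {e : (ThetaSetting.modelχq p i j hj).toTemperedCurve.GroupLevelData} {N : ℕ+} (μ : (ThetaSetting.modelχq p i j hj).CyclotomeMod l N)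
  (hC : (ThetaSetting.modelχq p i j hj).Compat) (hS : (ThetaSetting.modelχq p i j hj).Sec2Hyps)
  {D₀ : Type} [Category.{v₀} D₀] {V : FrdIMonoidStub.{0}} {T₀ : RealifiedDivisorMonoids (D₀ := D₀) V}
  {VD : FrdICatStub.{1, 0, 0} (ConnectedPart (BTemp (C.temperedArithmeticGroup e).Pi))}
  {tf : TemperedFrobenioid T₀ (ConnectedPart (BTemp (C.temperedArithmeticGroup e).Pi)) VD} {hZ : tf.monoidType = MonoidType.Z}
  {hP : ∀ A : (ConnectedPart (BTemp (C.temperedArithmeticGroup e).Pi))ᵒᵖ, IsPerfect (tf.Φ.carrier A)}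
  {NH : Subgroup (Field.absoluteGaloisGroup (ThetaSetting.modelχq p i j hj).K) → tf.category → ℕ+ → Prop}
  {pullFrac : ∀ {A A' : (BiKummerSetting.mkOfThetaSettingYdd C e μ hC hS tf hZ hP NH).C} (_ : A' ⟶ A),
    (BiKummerSetting.mkOfThetaSettingYdd C e μ hC hS tf hZ hP NH).biratUnits A →
      (BiKummerSetting.mkOfThetaSettingYdd C e μ hC hS tf hZ hP NH).biratUnits A'}
  {θ : (BiKummerSetting.mkOfThetaSettingYdd C e μ hC hS tf hZ hP NH).biratUnits (BiKummerSetting.mkOfThetaSettingYdd C e μ hC hS tf hZ hP NH).Aodot}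
  {Bl : (BiKummerSetting.mkOfThetaSettingYdd C e μ hC hS tf hZ hP NH).C}
  {Pl : (BiKummerSetting.mkOfThetaSettingYdd C e μ hC hS tf hZ hP NH).FractionPair θ Bl}
  {Rl : (BiKummerSetting.mkOfThetaSettingYdd C e μ hC hS tf hZ hP NH).NthRoot θ Pl C.lPNat pullFrac}
  (h : ModelFrobenioid.Hypotheses tf.divisorMonoid tf.ratFnFunctor)
  (Q : FrobenioidTheta.ThetaSubquotientStub.{0} (ConnectedPart (BTemp (C.temperedArithmeticGroup e).Pi)))
  (R : (BiKummerSetting.mkOfThetaSettingYdd C e μ hC hS tf hZ hP NH).NthRoot Rl.root Rl.pair N pullFrac)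
  (K' : Type) [Field K'] (constEmb : K'ˣ →* tf.biratUnitsModel R.BN) (constEmb_injective : Function.Injective constEmb)
  (hinvc : ∀ g : Aut R.AN.base,
    pull tf.divisorMonoid g.hom (ModelFrobenioid.div R.pair.num) = ModelFrobenioid.div R.pair.num)
  (hinvp : ∀ y : (C.thetaEnvData μ hC hS).PiX, y ∈ (C.thetaEnvData μ hC hS).PiYdd →
    pull tf.divisorMonoid ((BiKummerSetting.mkOfThetaSettingYdd C e μ hC hS tf hZ hP NH).galoisSurj
      R.AN.base R.αData.isGalois ((ContinuousMulEquiv.refl _) y)).hom (ModelFrobenioid.div R.pair.den) = ModelFrobenioid.div R.pair.den)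
  (hconst : ∀ (ε : Aut R.BN) (k : K'ˣ), tf.biratAutModel R.BN ε (constEmb k) = constEmb k)
  (m : (ofThetaSettingData μ hC hS h Q R K' constEmb constEmb_injective hinvc hinvp).muTorsion
      (ofThetaSettingData μ hC hS h Q R K' constEmb constEmb_injective hinvc hinvp).BN N ≃* (C.thetaEnvData μ hC hS).mu)
  {Cst : Subgroup ((ofThetaSettingData μ hC hS h Q R K' constEmb constEmb_injective hinvc hinvp).biratUnits
      (ofThetaSettingData μ hC hS h Q R K' constEmb constEmb_injective hinvc hinvp).BN)}
  {ν' : Cst →* (PadicAlgCl p)ˣ}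
  (hD : BiratAutAction.ConstantsDictionary
    (biratAutAction_ofConnectedTemperoidData (T := C.thetaEnvData μ hC hS) h Q C.odd_lPNat R (ContinuousMulEquiv.refl _) K' constEmb
      constEmb_injective hinvc hinvp hconst) C μ hC hS (ContinuousMulEquiv.refl _) m Cst ν')
  (hl : l.Prime) (hp2 : p ≠ 2) (hpl : p ≠ l) (hζ : ∃ ζ : (ThetaSetting.modelχq p i j hj).K, IsPrimitiveRoot ζ (4 * l))
  {η : (C.thetaEnvData μ hC hS).PiYdd → MuN p N} (hη : η ∈ (C.thetaEnvData μ hC hS).thetaCocycles)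

/-- **[EtTh] Theorem 5.10 (ii) ∧ (iii) AT THE Ÿ̲̲-JUNCTION DATA OVER THE STAGE-2 TATE MODELS `D := modelχq p i j`, `_canonical` END FORM,
with NO anabelian hypothesis left in the F-0620 slot**: the clause «`Δ^tp_X̲̲` characteristic» is abc-iut-w4-d044's theorem there modulo the
identification binder `eΔ` (geometric part of the completion package ≃ₜ* an open subgroup of `F̂₂`) and the classical statement `hI0` («the Tate
character pair `σ ↦ ((κ_p σ)^i, (κ_p σ)^j, χ σ)` is not injective on `G_{ℚ_p}`»).  RESIDUAL EXACTLY {junction data over the model, `hconst`,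
`hD`, `m`, the transports, `ψY`} ∪ {`hl`, `hp2`, `hpl`, `hζ`, `η`/`hη`, `U`, `hU`, `eΔ`, `hI0`}.  `modelχq` is SEMI-SYNTHETIC (joint-satisfiability
evidence for OUR typed interface, not the tempered `π₁` of a curve).
[cite: MochizukiEtTh2009, Thm 5.10 (ii)(iii) p.333–335 (PDF pp.107–109)] [cite: MochizukiAbsTopI2012, Thm 2.6 (v) p.22] -/
theorem thm510_ii_iii_ofThetaSettingYdd_modelχq_of_ker_ne_bot_canonical (hI0 : (SettingModel.tatePairHom p i j).ker ≠ ⊥)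
    (U : Subgroup (profiniteCompletion (FreeGroup (Fin 2)))) (hU : IsOpen (U : Set (profiniteCompletion (FreeGroup (Fin 2)))))
    (eΔ : ((Literature.IUT.HodgeArakelov.ThetaSetting.ofDoubleUnderline C μ hC hS hl hp2 hpl hζ hη).completionPackage
        (ThetaSetting.modelχq p i j hj).K (ThetaSetting.modelχq p i j hj).toTemperedCurve.galoisIdentification).geom ≃ₜ* U)
    (Ψ : (BiKummerSetting.mkOfThetaSettingYdd C e μ hC hS tf hZ hP NH).C ≌ (BiKummerSetting.mkOfThetaSettingYdd C e μ hC hS tf hZ hP NH).C)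
    (β : Ψ.functor.obj (ofThetaSettingData μ hC hS h Q R K' constEmb constEmb_injective hinvc hinvp).BN ≅
      (ofThetaSettingData μ hC hS h Q R K' constEmb constEmb_injective hinvc hinvp).BN)
    (ΨbiratAut : (ofThetaSettingData μ hC hS h Q R K' constEmb constEmb_injective hinvc hinvp).biratUnits
        (ofThetaSettingData μ hC hS h Q R K' constEmb constEmb_injective hinvc hinvp).BN ≃*
      (ofThetaSettingData μ hC hS h Q R K' constEmb constEmb_injective hinvc hinvp).biratUnits
        (ofThetaSettingData μ hC hS h Q R K' constEmb constEmb_injective hinvc hinvp).BN)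
    (Ψbs : ConnectedPart (BTemp (C.temperedArithmeticGroup e).Pi) ⥤ ConnectedPart (BTemp (C.temperedArithmeticGroup e).Pi))
    [Ψbs.Faithful]
    (eΨ : Ψ.functor ⋙ (ofThetaSettingData μ hC hS h Q R K' constEmb constEmb_injective hinvc hinvp).base ≅
      (ofThetaSettingData μ hC hS h Q R K' constEmb constEmb_injective hinvc hinvp).base ⋙ Ψbs)
    (hsq : ∀ u : (ofThetaSettingData μ hC hS h Q R K' constEmb constEmb_injective hinvc hinvp).units
        (ofThetaSettingData μ hC hS h Q R K' constEmb constEmb_injective hinvc hinvp).BN,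
      ∀ hu : (ofThetaSettingData μ hC hS h Q R K' constEmb constEmb_injective hinvc hinvp).psiAut Ψ β u ∈
        (ofThetaSettingData μ hC hS h Q R K' constEmb constEmb_injective hinvc hinvp).units
          (ofThetaSettingData μ hC hS h Q R K' constEmb constEmb_injective hinvc hinvp).BN,
      ΨbiratAut ((ofThetaSettingData μ hC hS h Q R K' constEmb constEmb_injective hinvc hinvp).unitsToBirat
          (ofThetaSettingData μ hC hS h Q R K' constEmb constEmb_injective hinvc hinvp).BN u) =
        (ofThetaSettingData μ hC hS h Q R K' constEmb constEmb_injective hinvc hinvp).unitsToBirat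
          (ofThetaSettingData μ hC hS h Q R K' constEmb constEmb_injective hinvc hinvp).BN ⟨_, hu⟩)
    (hΨconst : (ofThetaSettingData μ hC hS h Q R K' constEmb constEmb_injective hinvc hinvp).constEmb.range.map ΨbiratAut.toMonoidHom =
      (ofThetaSettingData μ hC hS h Q R K' constEmb constEmb_injective hinvc hinvp).constEmb.range)
    (αA : Ψ.functor.obj (ofThetaSettingData μ hC hS h Q R K' constEmb constEmb_injective hinvc hinvp).AN ≅
      (ofThetaSettingData μ hC hS h Q R K' constEmb constEmb_injective hinvc hinvp).AN)
    (eA : (ofThetaSettingData μ hC hS h Q R K' constEmb constEmb_injective hinvc hinvp).AN ≅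
      (ofThetaSettingData μ hC hS h Q R K' constEmb constEmb_injective hinvc hinvp).AN)
    (Dc Dp : Aut (ofThetaSettingData μ hC hS h Q R K' constEmb constEmb_injective hinvc hinvp).BN)
    (hRT : (ofThetaSettingData μ hC hS h Q R K' constEmb constEmb_injective hinvc hinvp).RootTransportWith Ψ αA β eA Dc Dp)
    (θA : Aut ((ofThetaSettingData μ hC hS h Q R K' constEmb constEmb_injective hinvc hinvp).base.obj
        (ofThetaSettingData μ hC hS h Q R K' constEmb constEmb_injective hinvc hinvp).BN) ≃*
      Aut ((ofThetaSettingData μ hC hS h Q R K' constEmb constEmb_injective hinvc hinvp).base.obj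
        (ofThetaSettingData μ hC hS h Q R K' constEmb constEmb_injective hinvc hinvp).BN))
    (hST : (ofThetaSettingData μ hC hS h Q R K' constEmb constEmb_injective hinvc hinvp).StrvTransport Ψ αA eA θA)
    (hθY : (ofThetaSettingData μ hC hS h Q R K' constEmb constEmb_injective hinvc hinvp).imPiY.map θA.toMonoidHom =
      (ofThetaSettingData μ hC hS h Q R K' constEmb constEmb_injective hinvc hinvp).imPiY)
    (hθYdd : (ofThetaSettingData μ hC hS h Q R K' constEmb constEmb_injective hinvc hinvp).HB.map θA.toMonoidHom =
      (ofThetaSettingData μ hC hS h Q R K' constEmb constEmb_injective hinvc hinvp).HB)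
    (ψY : (ofThetaSettingData μ hC hS h Q R K' constEmb constEmb_injective hinvc hinvp).PiX ≃ₜ*
      (ofThetaSettingData μ hC hS h Q R K' constEmb constEmb_injective hinvc hinvp).PiX)
    (hbase : ∀ g, (ofThetaSettingData μ hC hS h Q R K' constEmb constEmb_injective hinvc hinvp).autBase
        (ofThetaSettingData μ hC hS h Q R K' constEmb constEmb_injective hinvc hinvp).BN
        ((ofThetaSettingData μ hC hS h Q R K' constEmb constEmb_injective hinvc hinvp).psiAut Ψ β
          ((ofThetaSettingData μ hC hS h Q R K' constEmb constEmb_injective hinvc hinvp).sgpCap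
            ((ofThetaSettingData μ hC hS h Q R K' constEmb constEmb_injective hinvc hinvp).ρ g))) =
      (ofThetaSettingData μ hC hS h Q R K' constEmb constEmb_injective hinvc hinvp).ρ (ψY g))
    (hψY : (ofThetaSettingData μ hC hS h Q R K' constEmb constEmb_injective hinvc hinvp).PiY.map ψY.toMulEquiv.toMonoidHom =
      (ofThetaSettingData μ hC hS h Q R K' constEmb constEmb_injective hinvc hinvp).PiY)
    (hψYdd : (ofThetaSettingData μ hC hS h Q R K' constEmb constEmb_injective hinvc hinvp).PiYdd.map ψY.toMulEquiv.toMonoidHom =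
      (ofThetaSettingData μ hC hS h Q R K' constEmb constEmb_injective hinvc hinvp).PiYdd) :
    (ofThetaSettingData μ hC hS h Q R K' constEmb constEmb_injective hinvc hinvp).PsiAutPreserves Ψ β ΨbiratAut ∧
      (ofThetaSettingData μ hC hS h Q R K' constEmb constEmb_injective hinvc hinvp).MonoThetaEnvCompat
        (facts_ofThetaSettingYddData_of_constantsDictionary (hD' := hD)).sectionsFactor
        (ofThetaSettingData μ hC hS h Q R K' constEmb constEmb_injective hinvc hinvp).outerActionLZ_of
        (facts_ofThetaSettingYddData_of_constantsDictionary (hD' := hD)).sgpCapSection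
        (facts_ofThetaSettingYddData_of_constantsDictionary (hD' := hD)).sgpCupSection
        (facts_ofThetaSettingYddData_of_constantsDictionary (hD' := hD)).constantsEqNormalizer
        (dkOfConnectedTemperoidData (T := C.thetaEnvData μ hC hS) h Q C.odd_lPNat R (ContinuousMulEquiv.refl _) K' constEmb
          constEmb_injective hinvc hinvp hconst
          (kxRootNModCyclotome_ofThetaSettingData_of_constantsDictionary μ hC hS h Q R K' constEmb constEmb_injective hinvc hinvp hconst m hD))
        Ψ β ψY hbase hψY hψYdd :=
  thm510_ii_iii_ofThetaSettingYdd_of_isTopCharacteristic_canonical μ hC hS h Q R K' constEmb constEmb_injective hinvc hinvp hconst m hD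
    (SettingModel.isTopCharacteristic_deltaTemp_subgroupOf_Huu_modelχq_of_ker_ne_bot p i j hj C μ hC hS hl hp2 hpl hζ hη hI0 U hU eΔ)
    Ψ β ΨbiratAut Ψbs eΨ hsq hΨconst αA eA Dc Dp hRT θA hST hθY hθYdd
    ψY hbase hψY hψYdd

end TateJunction

end ThetaFrobenioid

end Literature.AnabelianGeometry.EtaleTheta

end
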